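import Mathlib.Data.Real.Basic
import Mathlib.Tactic.Linarith
import Mathlib.Tactic.Positivity
import Mathlib.Tactic.Ring
import Mathlib.Tactic.FieldSimp
import Mathlib.Tactic.LinearCombination
import HarnessLib

/-!
# `NoHeavyLowerTail` (stmt-CriticalPhenomena-4575) — the four-point closure is a cell MIXTURE: the perspective defect,
# the cubic chord defect, and the third-order budget of the apex-edge mixture (algebraic core)

Support file (prover seat `prim-ineq-gen-8`, gen 33; `--supports stmt-CriticalPhenomena-4575`; memo
`run/shared/lean/prim/prim-ineq-gen-8/FINDING-gen33-MIXTURE.md`).  Pure real algebra, no definitions, no named facts, no sorries.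

CONTEXT.  For an instance `(a; b, c)` of a finite weighted graph with cells `u0 = P(a|b|c)`, `uab`, `uac`, `ubc`, `u3`, write
`D = P(b ↮ c) = u0 + uab + uac`, `q = (uab, uac)/D`, `r = P(a ↔ {b,c}) = uab + uac + u3`; the tree envelope of gen 32 is
`TE = {r ≤ φ(q)}`, `φ(q) = 1 − exp(−F(X(q), Y(q)))`.  Gen 33 (memo §1) observes that conditioning on an apex edge `e = (a,x)` of
weight `p` writes the cell vector of `G` as the MIXTURE `(1−p)·cells(G − e) + p·cells(G / e)`; the two corners have
`D`-values `D₀ ≥ D₁` differing by the cross mass `χ = P(ab|xc) + P(ac|xb)`, and along the mixture the ratio coordinate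
`q(p) = ((1−p)D₀q₀ + pD₁q₁)/((1−p)D₀ + pD₁)` is a `D`-weighted (linear-fractional) average while `r(p)` is the plain average.
This file records the three exact identities behind memo §2–§3:
* `APL.ratioChord_defect` — the perspective defect: the `D`-weighted average of `A₀, A₁` minus their plain chord equals
  `p(1−p)(D₀−D₁)(A₀−A₁)/((1−p)D₀+pD₁)` (negative when the contracted corner has the smaller `D` and the larger value);
* `APL.cubicChord_defect` — `(1−p)a³ + p b³ − ((1−p)a + p b)³ = p(1−p)(b−a)²(3((1−p)a+pb) + (1−2p)(b−a))`, the gain of a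
  cubic envelope correction along a chord;
* `APL.envelope_second_order_vanishes` — with `p + q = 1`, the two first-order relations `pα + qβ = κ`,
  `p²α + q²β = 2κ − κ²` of the characteristic ODE of `F` (gen 32 §3(c)) force `α(p²/2 + pq) + β(q²/2 + pq) = κ²/2`, i.e. the
  second-order term of `φ − F` vanishes identically, so `φ = F + (cubic) + …` near the tip (memo §3(a));
* `APL.thirdOrder_mixture_budget` — for the cubic model `φ(t, D) = g t/D − k t³` with both corners tight
  (`r₀ = g t₀/D₀ − k t₀³`, `r₁ = g t₁/D₁ − k t₁³`) and parallel directions, the slack of the mixture at parameter `p` is exactly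
  `p(1−p)·[ k (t₁−t₀)² (3 t(p) + (1−2p)(t₁−t₀)) − g (D₀−D₁)(t₁/D₁ − t₀/D₀)/D(p) ]`, `t(p) = (1−p)t₀ + p t₁`,
  `D(p) = (1−p)D₀ + pD₁` — the competition "cubic concavity gain versus cross-mass perspective defect" of memo §3(b).
-/

namespace Summit.CriticalPhenomena.PercolationContinuityZ3.Theorems

namespace APL

/-- **Perspective defect of the ratio coordinate along a cell mixture.**  If the corner cell vectors have
`b ↮ c` masses `D₀, D₁ > 0` and ratio coordinates `A₀, A₁`, the mixture with weight `p` has ratio coordinate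
`((1−p)D₀A₀ + pD₁A₁)/((1−p)D₀ + pD₁)`, which differs from the chord `(1−p)A₀ + pA₁` by exactly
`p(1−p)(D₀−D₁)(A₀−A₁)/((1−p)D₀+pD₁)` (gen 33 memo §2). [this work] -/
theorem ratioChord_defect (p D₀ D₁ A₀ A₁ : ℝ) (hD : (1 - p) * D₀ + p * D₁ ≠ 0) :
    ((1 - p) * D₀ * A₀ + p * D₁ * A₁) / ((1 - p) * D₀ + p * D₁) - ((1 - p) * A₀ + p * A₁)
      = p * (1 - p) * (D₀ - D₁) * (A₀ - A₁) / ((1 - p) * D₀ + p * D₁) := by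
  rw [eq_div_iff hD, sub_mul, div_mul_cancel₀ _ hD]
  ring

/-- **Cubic chord defect.**  `(1−p)a³ + p b³ − ((1−p)a + p b)³ = p(1−p)(b−a)²·(3((1−p)a + p b) + (1−2p)(b−a))`; for
`p ∈ [0,1]` and `0 ≤ a ≤ b` the right-hand side is nonnegative, which is the concavity gain of the cubic correction `−k t³`
(`k ≥ 0`) of the envelope along a chord (gen 33 memo §3). [this work] -/
theorem cubicChord_defect (p a b : ℝ) :
    (1 - p) * a ^ 3 + p * b ^ 3 - ((1 - p) * a + p * b) ^ 3
      = p * (1 - p) * (b - a) ^ 2 * (3 * ((1 - p) * a + p * b) + (1 - 2 * p) * (b - a)) := by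
  ring

/-- Sign of the cubic chord defect: for `0 ≤ p ≤ 1` and `0 ≤ a ≤ b` the chord of `t ↦ t³` lies above the curve. [this work] -/
theorem cubicChord_defect_nonneg (p a b : ℝ) (hp0 : 0 ≤ p) (hp1 : p ≤ 1) (ha : 0 ≤ a) (hab : a ≤ b) :
    0 ≤ (1 - p) * a ^ 3 + p * b ^ 3 - ((1 - p) * a + p * b) ^ 3 := by
  rw [cubicChord_defect]
  have h1 : 0 ≤ 1 - p := by linarith
  have hb : 0 ≤ b := le_trans ha hab
  have hd : 0 ≤ b - a := by linarith
  have hm : 0 ≤ 3 * ((1 - p) * a + p * b) + (1 - 2 * p) * (b - a) := by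
    have e1 : 3 * ((1 - p) * a + p * b) + (1 - 2 * p) * (b - a) = (2 - p) * a + (1 + p) * b := by ring
    rw [e1]
    have : 0 ≤ 2 - p := by linarith
    positivity
  positivity

/-- **The second-order term of the envelope vanishes identically (characteristic ODE).**  With `p + q = 1`, `p, q ≠ 0`,
`p ≠ q`, the relations `pα + qβ = κ` and `p²α + q²β = 2κ − κ²` (gen 32 §3(c): `α = F_X`, `β = F_Y`, `κ = g(θ)` on the
envelope) give `α + β = κ(κ−1)/(pq)` and hence `α(p²/2 + pq) + β(q²/2 + pq) = κ²/2`; the left side is the second-order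
Taylor term of `F(X(q),Y(q))` and `κ²/2` that of `F²/2`, so `φ = 1 − e^{−F} = F + O(|q|³)` with NO quadratic correction
(gen 33 memo §3(a)). [this work] -/
theorem envelope_second_order_vanishes (p q α β κ : ℝ) (hpq : p + q = 1)
    (h1 : p * α + q * β = κ) (h2 : p ^ 2 * α + q ^ 2 * β = 2 * κ - κ ^ 2) :
    α * (p ^ 2 / 2 + p * q) + β * (q ^ 2 / 2 + p * q) = κ ^ 2 / 2 := by
  have hq : q = 1 - p := by linarith
  subst hq
  -- pq(α+β) = (pα+qβ) − (p²α+q²β) when p+q=1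
  have hsum : p * (1 - p) * (α + β) = κ - (2 * κ - κ ^ 2) := by
    have : p * (1 - p) * (α + β) = (p * α + (1 - p) * β) - (p ^ 2 * α + (1 - p) ^ 2 * β) := by ring
    rw [this, h1, h2]
  linear_combination (1 / 2 : ℝ) * h2 + hsum

/-- **Third-order budget of the apex-edge mixture (cubic model, parallel tight corners).**  In the model
`φ(t, D) = g·t/D − k·t³` of the envelope near the tip (first-order cone slope `g`, cubic correction `−k`, `k ≥ 0`), let the two
corners be tight, `r₀ = g t₀/D₀ − k t₀³`, `r₁ = g t₁/D₁ − k t₁³`, with `D₀, D₁ > 0`.  Along the cell mixture,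
`t(p) = (1−p)t₀ + p t₁`, `D(p) = (1−p)D₀ + pD₁`, `r(p) = (1−p)r₀ + p r₁`, and the model slack
`g·t(p)/D(p) − k·(t(p)/1)³ − r(p)` — with the cubic evaluated on the chord scale `t(p)` — equals
`p(1−p)·[k (t₁−t₀)²(3t(p) + (1−2p)(t₁−t₀)) − g (D₀−D₁)(t₁/D₁ − t₀/D₀)/D(p)]`:
cubic concavity gain against the perspective defect driven by the cross mass `D₀ − D₁ = χ` (gen 33 memo §3(b)). [this work] -/
theorem thirdOrder_mixture_budget (p g k t₀ t₁ D₀ D₁ r₀ r₁ : ℝ) (hD₀ : D₀ ≠ 0) (hD₁ : D₁ ≠ 0)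
    (hD : (1 - p) * D₀ + p * D₁ ≠ 0)
    (hr₀ : r₀ = g * t₀ / D₀ - k * t₀ ^ 3) (hr₁ : r₁ = g * t₁ / D₁ - k * t₁ ^ 3) :
    g * ((1 - p) * t₀ + p * t₁) / ((1 - p) * D₀ + p * D₁) - k * ((1 - p) * t₀ + p * t₁) ^ 3 - ((1 - p) * r₀ + p * r₁)
      = p * (1 - p) * (k * (t₁ - t₀) ^ 2 * (3 * ((1 - p) * t₀ + p * t₁) + (1 - 2 * p) * (t₁ - t₀))
          - g * (D₀ - D₁) * (t₁ / D₁ - t₀ / D₀) / ((1 - p) * D₀ + p * D₁)) := by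
  subst hr₀ hr₁
  field_simp
  ring

end APL

end Summit.CriticalPhenomena.PercolationContinuityZ3.Theorems
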